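import Mathlib
import Literature.MathematicalPhysics.QuantumFieldTheory.ContinuumLimitsYM2ConvolutionProofs
import Literature.MathematicalPhysics.QuantumFieldTheory.WilsonTorusTransferMatrix
import HarnessLib

/-!
# The class-averaged one-plaquette kernel of a central weight and its convolution powers

Group-theoretic half of the exact solution of two-dimensional lattice gauge theory (Migdal 1975; Driver 1989;
transfer-matrix form).  For a compact group `G` with Haar probability measure `dx` and a continuous CENTRAL weight
`ω : G → ℝ` (`ω(h g h⁻¹) = ω(g)`; in lattice gauge theory `ω = exp(β Re tr ρ)`), consider the kernels

  `k_m(A, B) = ∫ ω^{⋆(m+1)}(A⁻¹ x B x⁻¹) dx`,   `ω^{⋆(m+1)} = (haarConv ω)^[m] ω`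

on `G` (all objects are variables with their defining equations as hypotheses; no definition is introduced).
`k_0` is the kernel of "convolution by `ω` followed by the projection onto class functions", the transfer operator of
one plaquette rolled up into a cylinder; we PROVE

* `central_haarConv`, `symm_haarConv` and their iterates — convolution powers of a central (symmetric) weight are
  central (symmetric);
* `continuous_uncurry_kernel`, `abs_kernel_le`, `kernel_nonneg`, `kernel_pos`, `kernel_symm`,
  `kernel_conj_left` — regularity, positivity, symmetry and class invariance of the kernels;
* `integral_kernel_zero_mul_kernel` (**sewing**) — `∫ k_0(A, C) k_m(C, B) dC = k_{m+1}(A, B)`: the kernels are the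
  composition powers of `k_0` (conjugation invariance of Haar measure and Fubini);
* `posType_kernel_zero` — if `(x, y) ↦ ω(x y⁻¹)` is of positive type then so is `k_0` (double gauge average,
  `integral_integral_fibreAverage_nonneg`).

References: A. A. Migdal, Sov. Phys. JETP 42 (1975) 413; B. K. Driver, Commun. Math. Phys. 123 (1989) 575, §7;
E. Seiler, LNP 159 (1982) Ch. 2.
-/

set_option autoImplicit false

noncomputable section

open scoped BigOperators
open MeasureTheory Filter Function
open Literature.MathematicalPhysics.QuantumLattice Literature.MathematicalPhysics.QuantumFieldTheory

namespace Literature.MathematicalPhysics.QuantumFieldTheory.CentralKernel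

variable {G : Type*} [Group G] [TopologicalSpace G] [IsTopologicalGroup G] [CompactSpace G] [MeasurableSpace G]
  [BorelSpace G]

/-! ### Central and symmetric weights under convolution -/

/-- **The convolution of two central functions is central** (substitute `x ↦ h x h⁻¹`). [folklore] -/
theorem central_haarConv {φ ψ : G → ℝ} (hφ : ∀ g h, φ (h * g * h⁻¹) = φ g) (hψ : ∀ g h, ψ (h * g * h⁻¹) = ψ g)
    (g h : G) : haarConv φ ψ (h * g * h⁻¹) = haarConv φ ψ g := by
  rw [haarConv_apply, haarConv_apply, ← integral_haar_conj_eq (fun x => φ x * ψ (x⁻¹ * (h * g * h⁻¹))) h h⁻¹]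
  refine integral_congr_ae (Eventually.of_forall fun x => ?_)
  dsimp only
  rw [hφ]
  congr 1
  have e : (h * x * h⁻¹)⁻¹ * (h * g * h⁻¹) = h * (x⁻¹ * g) * h⁻¹ := by group
  rw [e, hψ]

/-- **The convolution of two symmetric functions, the second central, is symmetric** under inversion. [folklore] -/
theorem symm_haarConv {φ ψ : G → ℝ} (hφ : ∀ g, φ g⁻¹ = φ g) (hψ : ∀ g, ψ g⁻¹ = ψ g)
    (hψc : ∀ g h, ψ (h * g * h⁻¹) = ψ g) (g : G) : haarConv φ ψ g⁻¹ = haarConv φ ψ g := by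
  rw [haarConv_apply, haarConv_apply, ← integral_inv_eq_self (fun x => φ x * ψ (x⁻¹ * g)) (haarProbability G)]
  refine integral_congr_ae (Eventually.of_forall fun x => ?_)
  dsimp only
  rw [inv_inv, hφ, ← mul_inv_rev, hψ]
  congr 1
  have e : g * x = g * (x * g) * g⁻¹ := by group
  rw [e, hψc]

/-- The convolution powers `ω^{⋆(m+1)} = (haarConv ω)^[m] ω` of a central weight are central. [folklore] -/
theorem central_haarConv_iterate {ω : G → ℝ} (hω : ∀ g h, ω (h * g * h⁻¹) = ω g) :
    ∀ (m : ℕ) (g h : G), ((haarConv ω)^[m] ω) (h * g * h⁻¹) = ((haarConv ω)^[m] ω) g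
  | 0, g, h => hω g h
  | m + 1, g, h => by
    rw [Function.iterate_succ_apply']
    exact central_haarConv hω (central_haarConv_iterate hω m) g h

/-- The convolution powers of a central symmetric weight are symmetric under inversion. [folklore] -/
theorem symm_haarConv_iterate {ω : G → ℝ} (hω : ∀ g h, ω (h * g * h⁻¹) = ω g) (hωi : ∀ g, ω g⁻¹ = ω g) :
    ∀ (m : ℕ) (g : G), ((haarConv ω)^[m] ω) g⁻¹ = ((haarConv ω)^[m] ω) g
  | 0, g => hωi g
  | m + 1, g => by
    rw [Function.iterate_succ_apply']
    exact symm_haarConv hωi (symm_haarConv_iterate hω hωi m) (central_haarConv_iterate hω m) g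

/-- The integral of a continuous strictly positive function over a probability measure on a compact space is
strictly positive (the minimum is attained). [folklore] -/
theorem integral_pos_of_continuous {X : Type*} [TopologicalSpace X] [CompactSpace X] [Nonempty X]
    [MeasurableSpace X] [OpensMeasurableSpace X] {μ : Measure X} [IsProbabilityMeasure μ] {f : X → ℝ}
    (hf : Continuous f) (h0 : ∀ x, 0 < f x) : 0 < ∫ x, f x ∂μ := by
  obtain ⟨x₀, -, hx₀⟩ := isCompact_univ.exists_isMinOn Set.univ_nonempty hf.continuousOn
  have hmin : ∀ x, f x₀ ≤ f x := fun x => hx₀ (Set.mem_univ x)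
  calc 0 < f x₀ := h0 x₀
    _ = ∫ _x, f x₀ ∂μ := by rw [integral_const, smul_eq_mul, probReal_univ, one_mul]
    _ ≤ ∫ x, f x ∂μ := integral_mono (integrable_const _)
        (hf.integrable_of_hasCompactSupport (HasCompactSupport.of_compactSpace f)) hmin

/-- The convolution of two continuous strictly positive functions is strictly positive. [folklore] -/
theorem haarConv_pos {φ ψ : G → ℝ} (hφ : Continuous φ) (hψ : Continuous ψ) (hφ0 : ∀ g, 0 < φ g)
    (hψ0 : ∀ g, 0 < ψ g) (x : G) : 0 < haarConv φ ψ x := by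
  rw [haarConv_apply]
  exact integral_pos_of_continuous (hφ.mul (hψ.comp (continuous_inv.mul continuous_const)))
    fun g => mul_pos (hφ0 g) (hψ0 _)

/-- The convolution powers of a continuous strictly positive weight are strictly positive. [folklore] -/
theorem haarConv_iterate_pos {ω : G → ℝ} (hωc : Continuous ω) (hω0 : ∀ g, 0 < ω g) :
    ∀ (m : ℕ) (g : G), 0 < ((haarConv ω)^[m] ω) g
  | 0, g => hω0 g
  | m + 1, g => by
    rw [Function.iterate_succ_apply']
    exact haarConv_pos hωc (continuous_haarConv_iterate hωc m) hω0 (haarConv_iterate_pos hωc hω0 m) g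

/-- Integrability on `G × G` of a continuous function (compactness, second countability). [folklore] -/
theorem integrable_prod_of_continuous' [SecondCountableTopology G] {F : G × G → ℝ} (hF : Continuous F) :
    Integrable F ((haarProbability G).prod (haarProbability G)) :=
  hF.integrable_of_hasCompactSupport (HasCompactSupport.of_compactSpace F)

/-! ### The class-averaged kernels -/

section Kernel

variable (ω : G → ℝ) (k : ℕ → G → G → ℝ)
  (hk : ∀ m A B, k m A B = ∫ x, ((haarConv ω)^[m] ω) (A⁻¹ * x * B * x⁻¹) ∂haarProbability G)

include hk

/-- **Class invariance in the first argument**: `k_m(h C h⁻¹, B) = k_m(C, B)` (left invariance `x ↦ h x` of Haar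
measure and centrality of the convolution power). [folklore] -/
theorem kernel_conj_left (hω : ∀ g h, ω (h * g * h⁻¹) = ω g) (m : ℕ) (h C B : G) :
    k m (h * C * h⁻¹) B = k m C B := by
  rw [hk, hk, ← integral_mul_left_eq_self
    (fun x => ((haarConv ω)^[m] ω) ((h * C * h⁻¹)⁻¹ * x * B * x⁻¹)) h]
  refine integral_congr_ae (Eventually.of_forall fun x => ?_)
  dsimp only
  rw [← central_haarConv_iterate hω m (C⁻¹ * x * B * x⁻¹) h]
  group

/-- **Symmetry** `k_m(A, B) = k_m(B, A)` for a central symmetric weight (inversion invariance of Haar measure).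
[folklore] -/
theorem kernel_symm (hω : ∀ g h, ω (h * g * h⁻¹) = ω g) (hωi : ∀ g, ω g⁻¹ = ω g) (m : ℕ) (A B : G) :
    k m A B = k m B A := by
  rw [hk, hk, ← integral_inv_eq_self (fun x => ((haarConv ω)^[m] ω) (A⁻¹ * x * B * x⁻¹)) (haarProbability G)]
  refine integral_congr_ae (Eventually.of_forall fun x => ?_)
  dsimp only
  rw [inv_inv, ← symm_haarConv_iterate hω hωi m (B⁻¹ * x * A * x⁻¹),
    ← central_haarConv_iterate hω m (B⁻¹ * x * A * x⁻¹)⁻¹ x⁻¹]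
  group

/-- The kernels are non-negative for a non-negative weight. [folklore] -/
theorem kernel_nonneg (hω0 : ∀ g, 0 ≤ ω g) (m : ℕ) (A B : G) : 0 ≤ k m A B := by
  rw [hk]
  exact integral_nonneg fun x => haarConv_iterate_nonneg hω0 m _

/-- The kernels are bounded by the sup of the convolution power. [folklore] -/
theorem abs_kernel_le {m : ℕ} {C : ℝ} (hC : ∀ g, |((haarConv ω)^[m] ω) g| ≤ C) (A B : G) : |k m A B| ≤ C := by
  rw [hk]
  have h := norm_integral_le_of_norm_le_const (μ := haarProbability G)
    (f := fun x => ((haarConv ω)^[m] ω) (A⁻¹ * x * B * x⁻¹)) (C := C)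
    (Eventually.of_forall fun x => (Real.norm_eq_abs _).trans_le (hC _))
  rwa [probReal_univ, mul_one, Real.norm_eq_abs] at h

/-- The kernels are bounded. [folklore] -/
theorem exists_norm_kernel_le (hωc : Continuous ω) (m : ℕ) : ∃ C : ℝ, ∀ A B, ‖k m A B‖ ≤ C := by
  obtain ⟨C, -, hC⟩ := exists_forall_abs_le_of_continuous (continuous_haarConv_iterate hωc m)
  exact ⟨C, fun A B => (Real.norm_eq_abs _).trans_le (abs_kernel_le ω k hk hC A B)⟩

/-- **The kernels are strictly positive** for a continuous strictly positive weight. [folklore] -/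
theorem kernel_pos (hωc : Continuous ω) (hω0 : ∀ g, 0 < ω g) (m : ℕ) (A B : G) : 0 < k m A B := by
  rw [hk]
  exact integral_pos_of_continuous ((continuous_haarConv_iterate hωc m).comp
    (((continuous_const.mul continuous_id).mul continuous_const).mul continuous_inv))
    fun x => haarConv_iterate_pos hωc hω0 m _

variable [SecondCountableTopology G]

/-- **The kernels are jointly continuous** (dominated convergence on the compact parameter space). [folklore] -/
theorem continuous_uncurry_kernel (hωc : Continuous ω) (m : ℕ) : Continuous (uncurry (k m)) := by
  have hF : Continuous fun z : (G × G) × G => ((haarConv ω)^[m] ω) (z.1.1⁻¹ * z.2 * z.1.2 * z.2⁻¹) :=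
    (continuous_haarConv_iterate hωc m).comp ((((continuous_fst.comp continuous_fst).inv.mul continuous_snd).mul
      (continuous_snd.comp continuous_fst)).mul continuous_snd.inv)
  obtain ⟨B, hB⟩ := isCompact_univ.exists_bound_of_continuousOn hF.continuousOn
  have he : uncurry (k m) = fun p : G × G => ∫ x, ((haarConv ω)^[m] ω) (p.1⁻¹ * x * p.2 * x⁻¹) ∂haarProbability G :=
    funext fun p => hk m p.1 p.2
  rw [he]
  refine continuous_of_dominated (bound := fun _ => B) (fun p => ?_) (fun p => ?_) (integrable_const B)
    (Eventually.of_forall fun x => ?_)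
  · exact (hF.comp (Continuous.prodMk continuous_const continuous_id)).aestronglyMeasurable
  · exact Eventually.of_forall fun x => hB (p, x) (Set.mem_univ _)
  · exact hF.comp (Continuous.prodMk continuous_id continuous_const)

/-- The kernels are jointly strongly measurable. [folklore] -/
theorem stronglyMeasurable_uncurry_kernel (hωc : Continuous ω) (m : ℕ) : StronglyMeasurable (uncurry (k m)) :=
  (continuous_uncurry_kernel ω k hk hωc m).stronglyMeasurable

/-- **Sewing: the kernels are the composition powers of `k_0`**,
`∫ k_0(A, C) k_m(C, B) dC = k_{m+1}(A, B)`.  Expand `k_0`, swap, remove the gauge average of `k_0` by the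
substitution `C ↦ x C x⁻¹` and class invariance of `k_m(·, B)`, expand `k_m`, swap, and recognise
`(ω ⋆ ω^{⋆(m+1)})(A⁻¹ y B y⁻¹)` after `C ↦ A⁻¹ C`. [cite: DriverCMP1989, Thm 7.4 (proof)] -/
theorem integral_kernel_zero_mul_kernel (hωc : Continuous ω) (hω : ∀ g h, ω (h * g * h⁻¹) = ω g) (m : ℕ)
    (A B : G) : ∫ C, k 0 A C * k m C B ∂haarProbability G = k (m + 1) A B := by
  set μ := haarProbability G with hμ
  set ψ : G → ℝ := (haarConv ω)^[m] ω with hψ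
  have hψc : Continuous ψ := continuous_haarConv_iterate hωc m
  have hkmc : Continuous fun C => k m C B :=
    (continuous_uncurry_kernel ω k hk hωc m).comp (Continuous.prodMk continuous_id continuous_const)
  -- (1) expand `k_0` and swap
  have hk0 : ∀ C, k 0 A C = ∫ x, ω (A⁻¹ * x * C * x⁻¹) ∂μ := fun C => by
    rw [hk]; simp only [Function.iterate_zero, id_eq]
  have h1 : ∫ C, k 0 A C * k m C B ∂μ = ∫ x, ∫ C, ω (A⁻¹ * x * C * x⁻¹) * k m C B ∂μ ∂μ := by
    simp_rw [hk0, ← integral_mul_const]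
    exact integral_integral_swap (integrable_prod_of_continuous'
      (((hωc.comp ((((continuous_const.mul continuous_snd).mul continuous_fst)).mul continuous_snd.inv)).mul
        (hkmc.comp continuous_fst))))
  -- (2) the inner integral does not depend on `x`
  have h2 : ∀ x, ∫ C, ω (A⁻¹ * x * C * x⁻¹) * k m C B ∂μ = ∫ C, ω (A⁻¹ * C) * k m C B ∂μ := fun x => by
    rw [← integral_haar_conj_eq (fun C => ω (A⁻¹ * C) * k m C B) x x⁻¹]
    refine integral_congr_ae (Eventually.of_forall fun C => ?_)
    dsimp only
    rw [kernel_conj_left ω k hk hω m x C B]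
    congr 2
    group
  -- (3) expand `k_m` and swap
  have h3 : ∫ C, ω (A⁻¹ * C) * k m C B ∂μ = ∫ y, ∫ C, ω (A⁻¹ * C) * ψ (C⁻¹ * y * B * y⁻¹) ∂μ ∂μ := by
    simp_rw [hk m, ← hψ, ← integral_const_mul]
    exact integral_integral_swap (integrable_prod_of_continuous'
      ((hωc.comp (continuous_const.mul continuous_fst)).mul
        (hψc.comp (((continuous_fst.inv.mul continuous_snd).mul continuous_const).mul continuous_snd.inv))))
  -- (4) the inner integral is the next convolution power
  have h4 : ∀ y, ∫ C, ω (A⁻¹ * C) * ψ (C⁻¹ * y * B * y⁻¹) ∂μ = ((haarConv ω)^[m + 1] ω) (A⁻¹ * y * B * y⁻¹) := by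
    intro y
    rw [Function.iterate_succ_apply', ← hψ, haarConv_apply,
      ← integral_mul_left_eq_self (fun C => ω C * ψ (C⁻¹ * (A⁻¹ * y * B * y⁻¹))) A⁻¹]
    refine integral_congr_ae (Eventually.of_forall fun C => ?_)
    dsimp only
    congr 2
    group
  rw [h1]
  simp_rw [h2]
  rw [integral_const, smul_eq_mul, probReal_univ, one_mul, h3]
  simp_rw [h4]
  rw [hk (m + 1)]

/-- The iterates of the pointwise transfer operator of `k_0` on a kernel section are the higher kernels:
`(κ^[m] k_0(·, B))(A) = k_m(A, B)`. [folklore] -/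
theorem iterate_kernel_zero_section (hωc : Continuous ω) (hω : ∀ g h, ω (h * g * h⁻¹) = ω g) (B : G) :
    ∀ (m : ℕ) (A : G), ((fun f : G → ℝ => fun w => ∫ z, k 0 w z * f z ∂haarProbability G)^[m] (fun C => k 0 C B)) A =
      k m A B
  | 0, A => rfl
  | m + 1, A => by
    rw [Function.iterate_succ_apply']
    have e : ((fun f : G → ℝ => fun w => ∫ z, k 0 w z * f z ∂haarProbability G)^[m] fun C => k 0 C B) =
        fun C => k m C B := funext fun C => iterate_kernel_zero_section hωc hω B m C
    rw [e]
    exact integral_kernel_zero_mul_kernel ω k hk hωc hω m A B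

/-- **`k_0` is of positive type when `(x, y) ↦ ω(x y⁻¹)` is**: for measurable `|f| ≤ 1`,
`∫∫ f(x) k_0(x, y) f(y) dx dy ≥ 0`.  Double gauge average: `k_0(x, y) = ∫∫ ω((a x a⁻¹)⁻¹ (b y b⁻¹)) da db`, so the
double integral is `∫∫ f̄(x) ω(x⁻¹ y) f̄(y)` with the class average `f̄` (`integral_integral_fibreAverage_nonneg` with
conjugation as fibre action and `(a, b) ↦ a b⁻¹` as doubling map). [cite: Luscher1977] -/
theorem posType_kernel_zero (hωc : Continuous ω) (hω : ∀ g h, ω (h * g * h⁻¹) = ω g) (hωi : ∀ g, ω g⁻¹ = ω g)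
    (hpt : ∀ φ : G → ℝ, Measurable φ → (∀ x, |φ x| ≤ 1) →
      0 ≤ ∫ z, φ z.1 * ω (z.1 * z.2⁻¹) * φ z.2 ∂((haarProbability G).prod (haarProbability G)))
    (f : G → ℝ) (hf : Measurable f) (hf1 : ∀ x, |f x| ≤ 1) :
    0 ≤ ∫ x, ∫ y, f x * k 0 x y * f y ∂haarProbability G ∂haarProbability G := by
  set μ := haarProbability G with hμ
  obtain ⟨C, hC0, hC⟩ := exists_forall_abs_le_of_continuous hωc
  set C' : ℝ := max C 1 with hC'
  have hC'0 : 0 < C' := lt_of_lt_of_le one_pos (le_max_right _ _)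
  have hω1 : ∀ g, |ω g / C'| ≤ 1 := fun g => by
    rw [abs_div, abs_of_pos hC'0, div_le_one hC'0]
    exact (hC g).trans (le_max_left _ _)
  -- `k_0 = C' ∫ (ω/C')(x⁻¹ a y a⁻¹) da`
  have hk0 : ∀ x y, k 0 x y = C' * ∫ a, ω (x⁻¹ * a * y * a⁻¹) / C' ∂μ := fun x y => by
    rw [hk, integral_div]
    simp only [Function.iterate_zero, id_eq]
    field_simp
  have heq : ∫ x, ∫ y, f x * k 0 x y * f y ∂μ ∂μ =
      C' * ∫ x, ∫ y, f x * (∫ a, ω (x⁻¹ * a * y * a⁻¹) / C' ∂μ) * f y ∂μ ∂μ := by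
    rw [← integral_const_mul]
    refine integral_congr_ae (Eventually.of_forall fun x => ?_)
    dsimp only
    rw [← integral_const_mul]
    refine integral_congr_ae (Eventually.of_forall fun y => ?_)
    dsimp only
    rw [hk0]
    ring
  rw [heq]
  refine mul_nonneg hC'0.le ?_
  have hTm : Measurable fun q : G × G => q.1 * q.2 * q.1⁻¹ :=
    ((continuous_fst.mul continuous_snd).mul continuous_fst.inv).measurable
  have hD : MeasurePreserving (fun p : G × G => p.1 * p.2⁻¹) (μ.prod μ) μ := by
    have h := (measurePreserving_fst (μ := μ) (ν := μ)).comp (measurePreserving_div_prod μ μ)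
    have e : (fun p : G × G => p.1 * p.2⁻¹) = Prod.fst ∘ fun z : G × G => (z.1 / z.2, z.2) := by
      funext p
      simp [div_eq_mul_inv]
    rw [e]
    exact h
  have hkm : Measurable fun q : G × G × G => ω (q.1⁻¹ * q.2.1 * q.2.2 * q.2.1⁻¹) / C' :=
    ((hωc.comp (((continuous_fst.inv.mul (continuous_fst.comp continuous_snd)).mul
      (continuous_snd.comp continuous_snd)).mul (continuous_fst.comp continuous_snd).inv)).div_const _).measurable
  have hk₀m : Measurable fun z : G × G => ω (z.1 * z.2⁻¹) / C' :=
    ((hωc.comp (continuous_fst.mul continuous_snd.inv)).div_const _).measurable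
  refine integral_integral_fibreAverage_nonneg μ μ (fun a x => a * x * a⁻¹) hTm (fun a => measurePreserving_conj a)
    (fun p => p.1 * p.2⁻¹) hD f hf hf1 (fun x a y => ω (x⁻¹ * a * y * a⁻¹) / C') hkm (fun x a y => hω1 _)
    (fun z => ω (z.1 * z.2⁻¹) / C') hk₀m (fun z => hω1 _) (fun p z => ?_) (fun φ hφ hφ1 => ?_)
  · rw [show (p.1 * z.1 * p.1⁻¹)⁻¹ * (p.1 * p.2⁻¹) * (p.2 * z.2 * p.2⁻¹) * (p.1 * p.2⁻¹)⁻¹ =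
      p.1 * (z.1⁻¹ * (z.1 * z.2⁻¹)⁻¹ * z.1⁻¹⁻¹) * p.1⁻¹ by group, hω, hω, hωi]
  · have e : ∫ z, φ z.1 * (ω (z.1 * z.2⁻¹) / C') * φ z.2 ∂μ.prod μ =
        (∫ z, φ z.1 * ω (z.1 * z.2⁻¹) * φ z.2 ∂μ.prod μ) / C' := by
      rw [← integral_div]
      refine integral_congr_ae (Eventually.of_forall fun z => ?_)
      dsimp only
      ring
    rw [e]
    exact div_nonneg (hpt φ hφ hφ1) hC'0.le

end Kernel

end Literature.MathematicalPhysics.QuantumFieldTheory.CentralKernel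

end
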